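import Literature.MathematicalPhysics.QuantumFieldTheory.Balaban1983to89.B9SectBGpReadingsY

/-!
# `Balaban1983to89.B9SectBL2ReadingsY` — the (3.46) READING of NODE 00's site-sector family, entry 0: the `L²` block of `kernelFamilyS` at a configuration gives
# the block-`ℓ²` majorant of the letter `conj b (η²·O)` on the real coordinate lattice (the field `L2Frame₂.readL2`, first conjunct, at the letters)

T. Bałaban, *Propagators for lattice gauge theories in a background field*, Commun. Math. Phys. **99** (1985) 389–434
[`Balaban1985BackgroundPropagators`, "B9"], Thm 3.1 (3.46) p. 398, (3.39)–(3.41) p. 397; T. Bałaban, *Propagators and renormalization transformations for lattice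
gauge theories. II*, Commun. Math. Phys. **96** (1984) 223–250 [`Balaban1984PropagatorsII`, "[4]"], (2.51)–(2.52) p. 232.

statement-level skeleton of published theorems with citation tags; proofs where landed; nothing here is a claim about the Yang–Mills mass gap

WHY THIS FILE (pub-ymgap N06 row 13, seat dag-n06-c gen 8; the L² member of item (O4)).  The Sect.-B frames carry the (3.46) READING field
`B9SectBL2StepAtLettersV2.L2Frame₂.readL2`: at a regular `U`, the `L²` block `B9FromB6.L2Block (Gp i) B₀ δ U` of the family must give block-`ℓ²` majorants
(`B6RandomWalkL2.HasL2Majorant`) of the letters `Gop` (entry 0) and `∇♯_k·Gop` (entry 1) on the real coordinate lattice.  THIS FILE proves ENTRY 0 for def-Y's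
site-sector reading `Node00.kernelFamilyS i B cfg O par` (any `B cfg O par`, any configuration) and the letter `conj b (η²·O(cfg c))` (at the record with `O :=
GpY par` this is `B9SectBGpLettersY.GopC` at `base U`), with the δ-INDEPENDENT constant `c_L = √|ι|·M₂·Σ_j‖b_j‖`: the `ℓ²` analogue of def-Y's sup-norm
reader `Node00.OpsYRead342` (cut-off `h :=` the indicator of the labelled block, `|h| ≦ 1`; argument `λ := u(·, j) ⊗ b_j∕‖b_j‖` per coordinate `j`).  Entry 1
(difference letters, both orientations) needs the augmented reading with the adjoint differences (as `B9SectBGpReadingsY.KSC` does for (3.42)) and is not in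
this file.

WHAT IS IN THE FILE (0 sorry; standard axioms; no definitions).
* §1 `ℓ²` tools: `indY` facts (the indicator cut-off of a labelled block: `cutIn`, `supF ≤ 1`), `l2OfY_eq_l2n`, `l2OfY_smul`, `l2OfY_sum_le`, `l2Norm_col_le`
  (a coordinate column is `ℓ²`-smaller than the whole), `l2n_blockPiece_conj_le` (the `ℓ²` size of a conj-`b` block piece against
  the `𝔸`-valued block `ℓ²` reading), `exists_ball_bound_l2OfY`.
* §2 ★★ `hasL2Majorant_conj_of_l2Block` — `L2Block (kernelFamilyS …) B₀ δ c → HasL2Majorant (blkC ιB ·) (conj b (η²·O(cfg c))) (c_L·B₀·ℓ(a)²·e^{−δd(a,a′)})`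
  at a member with a section `ιB` of `β`; ★ `hasL2Majorant_GopC_base_of_l2Block` (the record's letter at `base U`).

HONEST SCOPE.  A reader lemma (definitional bookkeeping + Cauchy–Schwarz-free `ℓ²` triangle inequalities); nothing of Theorem 3.1 asserted (the `L²` block is
the HYPOTHESIS); per-member under `hι`.  COUNT-NEUTRAL; N06 NOT discharged; one finite lattice programme — nothing continuum ∕ OS ∕ mass-gap ∕ Clay.
Cell `pub-ymgap` (HUMAN RULING D-0062), Track A node N06 [B9], row 13, 2026-08-28.
-/

namespace Literature.MathematicalPhysics.QuantumFieldTheory.Balaban1983to89.B9SectBL2ReadingsY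

open Literature.MathematicalPhysics.QuantumFieldTheory.Balaban1983to89
open Literature.MathematicalPhysics.QuantumFieldTheory.Balaban1983to89.B6KLevelCensusIndexV1 (KIdx kGeo)
open Literature.MathematicalPhysics.QuantumFieldTheory.Balaban1983to89.B6Ineq2142KLevelV1 (β)
open Literature.MathematicalPhysics.QuantumFieldTheory.Balaban1983to89.B6RandomWalk (blockPiece)
open Literature.MathematicalPhysics.QuantumFieldTheory.Balaban1983to89.B6RandomWalkL2 (l2n l2n_nonneg l2n_sq l2n_add_le l2n_sum_le l2n_smul l2n_mono HasL2Majorant)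
open Literature.MathematicalPhysics.QuantumFieldTheory.Balaban1983to89.B9Thm34Ext (toB6)
open Literature.MathematicalPhysics.QuantumFieldTheory.Balaban1983to89.B9FromB6 (L2Block)
open Literature.MathematicalPhysics.QuantumFieldTheory.Balaban1983to89.B9Eq352DivFormLetters (conj conj_apply coordEquiv coordEquiv_symm_apply)
open Literature.MathematicalPhysics.QuantumFieldTheory.Balaban1983to89.B9PinMembersKLevelV1 (MemberY geo9Y)
open Literature.MathematicalPhysics.QuantumFieldTheory.Balaban1983to89.B9SectBGpLettersY (blkC GopC decY)
open Literature.MathematicalPhysics.QuantumFieldTheory.Balaban1983to89.B9SectBGpReadingsY (exists_ball_bound suppIn_inl_of_blkC etaS_eq_eta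
  coordEquiv_symm_eq_sum_liftY real_smul_fun)
open Literature.MathematicalPhysics.QuantumFieldTheory.Balaban1983to89.B9Thm314WholeExpansionReads (le_iSup_ball)
open Literature.MathematicalPhysics.QuantumFieldTheory.Balaban1983to89.B9GeoLemma21KLevelV1 (geo9Y_len_pos geo9K_eta_pos)
open Literature.MathematicalPhysics.QuantumFieldTheory.Balaban1983to89.Node00 (SiteY BlkY IBondY CfgY BallY SiteOpY SiteParY liftY liftY_apply l2OfY etaS kernelFamilyS GpY)

variable {𝔸 : Type} [NormedRing 𝔸] [NormedAlgebra ℂ 𝔸] [CompleteSpace 𝔸] [FiniteDimensional ℝ 𝔸]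
variable {d ℓ : ℕ} {hd : 1 ≤ d + 1} {hL : Odd (ℓ + 1) ∧ 1 < ℓ + 1} {b₀ b₁ : ℝ} {Mstar : ℕ}

/-! ## §1 `ℓ²` tools on the site sector -/

section Tools

variable (x : MemberY d ℓ hd hL b₀ b₁ Mstar) (ιB : BlkY x.toKIdx → IBondY x.toKIdx) {ι : Type} [Fintype ι] (b : Module.Basis ι ℝ 𝔸)

open Classical in
/-- the indicator cut-off of the block labelled `y`. [cite: Balaban1985BackgroundPropagators, (3.46) p.398 («h»), bookkeeping] -/
def indY (y : IBondY x.toKIdx) : SiteY x.toKIdx → ℝ := fun z => if blkC x.toKIdx ιB z = y then 1 else 0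

omit [NormedAlgebra ℂ 𝔸] [CompleteSpace 𝔸] [FiniteDimensional ℝ 𝔸] [Fintype ι] in
/-- the indicator takes the values `0`, `1`. [cite: Balaban1985BackgroundPropagators, (3.46) p.398, bookkeeping] -/
theorem indY_nonneg_le_one (y : IBondY x.toKIdx) (z : SiteY x.toKIdx) : 0 ≤ indY x ιB y z ∧ indY x ιB y z ≤ 1 := by
  unfold indY; split_ifs <;> norm_num

omit [NormedAlgebra ℂ 𝔸] [CompleteSpace 𝔸] [FiniteDimensional ℝ 𝔸] [Fintype ι] in
/-- `|h| ≤ 1` for the indicator cut-off. [cite: Balaban1985BackgroundPropagators, (3.46) p.398 («|h|»), bookkeeping] -/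
theorem supF_indY_le_one (y : IBondY x.toKIdx) : (Node00.toKT x.toKIdx).supF (indY x ιB y) ≤ 1 := by
  unfold B6Prop22KLevelTorusCensus.KTIdx.supF
  refine Real.iSup_le (fun z => ?_) zero_le_one
  obtain ⟨h0, h1⟩ := indY_nonneg_le_one x ιB y z
  rw [abs_of_nonneg h0]; exact h1

omit [NormedAlgebra ℂ 𝔸] [FiniteDimensional ℝ 𝔸] [Fintype ι] in
/-- the indicator cut-off is supported in the genuine block `β y` (the labelling is a section of `β`).
[cite: Balaban1985BackgroundPropagators, (3.46) p.398 («supp h ⊂ Δ(y)»), bookkeeping] -/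
theorem cutIn_indY [Fintype (geo9Y x).Site] (hι : ∀ s : BlkY x.toKIdx, β x.toKIdx.hN x.toKIdx.D x.toKIdx.hk (ιB s) = s) (y : IBondY x.toKIdx) :
    (geo9Y x).cutIn (.inl (indY x ιB y)) y := by
  intro z hz
  have hzy : blkC x.toKIdx ιB z = y := by
    by_contra h
    exact hz (by unfold indY; rw [if_neg h])
  have h1 : β x.toKIdx.hN x.toKIdx.D x.toKIdx.hk (blkC x.toKIdx ιB z) = β x.toKIdx.hN x.toKIdx.D x.toKIdx.hk y := congrArg _ hzy
  have h2 : β x.toKIdx.hN x.toKIdx.D x.toKIdx.hk (blkC x.toKIdx ιB z) = B6Geom246MultiLevelBox.blkOf x.D.toDomains z := hι _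
  exact h2.symm.trans h1

omit [NormedAlgebra ℂ 𝔸] [CompleteSpace 𝔸] [FiniteDimensional ℝ 𝔸] [Fintype ι] in
/-- the block `ℓ²` reading with cut-off `h` IS the `ℓ²` norm of `h·‖Ψ‖`. [cite: Balaban1985BackgroundPropagators, (3.46) p.398, bookkeeping] -/
theorem l2OfY_eq_l2n (h : SiteY x.toKIdx → ℝ) (Ψ : SiteY x.toKIdx → 𝔸) : l2OfY h Ψ = l2n (fun z => h z * ‖Ψ z‖) := by
  unfold l2OfY l2n
  rw [EuclideanSpace.norm_eq]
  congr 1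
  refine Finset.sum_congr rfl fun z _ => ?_
  rw [Real.norm_eq_abs, sq_abs]

omit [CompleteSpace 𝔸] [FiniteDimensional ℝ 𝔸] [Fintype ι] in
/-- homogeneity of the block `ℓ²` reading for a nonnegative cut-off. [cite: Balaban1985BackgroundPropagators, (3.46) p.398, bookkeeping] -/
theorem l2OfY_smul {h : SiteY x.toKIdx → ℝ} (c : ℂ) (Ψ : SiteY x.toKIdx → 𝔸) : l2OfY h (c • Ψ) = ‖c‖ * l2OfY h Ψ := by
  rw [l2OfY_eq_l2n, l2OfY_eq_l2n, ← abs_norm, ← l2n_smul]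
  congr 1
  funext z
  rw [Pi.smul_apply, Pi.smul_apply, norm_smul, smul_eq_mul]
  ring

omit [NormedAlgebra ℂ 𝔸] [CompleteSpace 𝔸] [FiniteDimensional ℝ 𝔸] [Fintype ι] in
/-- sub-additivity of the block `ℓ²` reading along finite sums for a nonnegative cut-off. [cite: Balaban1985BackgroundPropagators, (3.46) p.398; Balaban1984PropagatorsII, (2.52) p.232] -/
theorem l2OfY_sum_le {h : SiteY x.toKIdx → ℝ} (hh : ∀ z, 0 ≤ h z) {β' : Type} (S : Finset β') (Ψ : β' → SiteY x.toKIdx → 𝔸) :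
    l2OfY h (∑ k ∈ S, Ψ k) ≤ ∑ k ∈ S, l2OfY h (Ψ k) := by
  rw [l2OfY_eq_l2n]
  simp only [l2OfY_eq_l2n]
  refine le_trans (l2n_mono (v := ∑ k ∈ S, fun z => h z * ‖Ψ k z‖) fun z => ?_) (l2n_sum_le S _)
  rw [Finset.sum_apply, Finset.sum_apply, ← Finset.mul_sum, abs_of_nonneg (mul_nonneg (hh z) (norm_nonneg _)),
    abs_of_nonneg (mul_nonneg (hh z) (Finset.sum_nonneg fun k _ => norm_nonneg _))]
  exact mul_le_mul_of_nonneg_left (norm_sum_le _ _) (hh z)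

omit [NormedRing 𝔸] [NormedAlgebra ℂ 𝔸] [CompleteSpace 𝔸] [FiniteDimensional ℝ 𝔸] in
/-- a coordinate column is `ℓ²`-smaller than the whole coordinate function. [cite: Balaban1984PropagatorsII, (2.51) p.232, bookkeeping] -/
theorem l2Norm_col_le [Fintype (geo9Y x).Site] (u : SiteY x.toKIdx × ι → ℝ) (j : ι) :
    (geo9Y x).l2Norm (.inl fun z => u (z, j)) ≤ l2n u := by
  show Real.sqrt (∑ z, (u (z, j)) ^ 2) ≤ l2n u
  have hsq : l2n u ^ 2 = ∑ p, u p ^ 2 := l2n_sq u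
  rw [Fintype.sum_prod_type] at hsq
  refine Real.sqrt_le_left (l2n_nonneg u) |>.mpr ?_ |> fun h => h
  · rw [hsq]
    exact Finset.sum_le_sum fun z _ => Finset.single_le_sum (fun j _ => sq_nonneg (u (z, j))) (Finset.mem_univ j)

omit [CompleteSpace 𝔸] [FiniteDimensional ℝ 𝔸] in
/-- **THE `ℓ²` SIZE OF A CONJ-`b` BLOCK PIECE** against the `𝔸`-valued block `ℓ²` reading: with coordinate constant `M₂`,
`l2n (Δ(y)(conj b T u))² ≤ |ι|·M₂²·(l2OfY 1_{Δ(y)} (T Λ_u))²`, `Λ_u = coord⁻¹ u`. [cite: Balaban1984PropagatorsII, (2.51)–(2.52) p.232; Balaban1985BackgroundPropagators, (3.39) p.397] -/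
theorem l2n_blockPiece_conj_le [Fintype (geo9Y x).Site] [DecidableEq (geo9Y x).Site] {M₂ : ℝ} (hM₂ : 0 ≤ M₂)
    (hrepr : ∀ (v : 𝔸) (j : ι), |b.repr v j| ≤ M₂ * ‖v‖) (R : ℝ) (H : Prop)
    (T : Module.End ℝ (SiteY x.toKIdx → 𝔸)) (u : SiteY x.toKIdx × ι → ℝ) (y : IBondY x.toKIdx) :
    l2n (blockPiece (g := toB6 (geo9Y x) R H) (fun p : SiteY x.toKIdx × ι => blkC x.toKIdx ιB p.1) y (conj b T u)) ≤
      Real.sqrt (Fintype.card ι) * M₂ * l2OfY (indY x ιB y) (T ((coordEquiv b).symm u)) := by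
  have hrhs : 0 ≤ Real.sqrt (Fintype.card ι) * M₂ * l2OfY (indY x ιB y) (T ((coordEquiv b).symm u)) := by
    unfold l2OfY; positivity
  refine (pow_le_pow_iff_left₀ (l2n_nonneg _) hrhs two_ne_zero).1 ?_
  rw [l2n_sq, mul_pow, mul_pow, Real.sq_sqrt (Nat.cast_nonneg _), l2OfY, Real.sq_sqrt (Finset.sum_nonneg fun _ _ => sq_nonneg _),
    Fintype.sum_prod_type, Finset.mul_sum]
  refine Finset.sum_le_sum fun z _ => ?_
  by_cases hz : blkC x.toKIdx ιB z = y
  · have hind : indY x ιB y z = 1 := by unfold indY; rw [if_pos hz]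
    rw [hind, one_mul]
    calc ∑ j, (blockPiece (g := toB6 (geo9Y x) R H) (fun p : SiteY x.toKIdx × ι => blkC x.toKIdx ιB p.1) y (conj b T u)) (z, j) ^ 2
        = ∑ j, (b.repr (T ((coordEquiv b).symm u) z) j) ^ 2 := by
          refine Finset.sum_congr rfl fun j _ => ?_
          rw [blockPiece]
          dsimp only
          split_ifs with hc
          · rw [conj_apply]
          · exact absurd hz hc
      _ ≤ ∑ _j : ι, (M₂ * ‖T ((coordEquiv b).symm u) z‖) ^ 2 :=
          Finset.sum_le_sum fun j _ => by
            have h := hrepr (T ((coordEquiv b).symm u) z) j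
            have h0 : 0 ≤ M₂ * ‖T ((coordEquiv b).symm u) z‖ := mul_nonneg hM₂ (norm_nonneg _)
            nlinarith [abs_nonneg (b.repr (T ((coordEquiv b).symm u) z) j), sq_abs (b.repr (T ((coordEquiv b).symm u) z) j)]
      _ = (Fintype.card ι : ℝ) * M₂ ^ 2 * ‖T ((coordEquiv b).symm u) z‖ ^ 2 := by
          rw [Finset.sum_const, Finset.card_univ, nsmul_eq_mul]; ring
  · have h0 : ∀ j, blockPiece (g := toB6 (geo9Y x) R H) (fun p : SiteY x.toKIdx × ι => blkC x.toKIdx ιB p.1) y (conj b T u) (z, j) = 0 := fun j => by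
      rw [blockPiece]
      dsimp only
      split_ifs with hc
      · exact absurd hc hz
      · rfl
    simp only [h0]
    rw [zero_pow two_ne_zero, Finset.sum_const_zero]
    positivity

omit [NormedAlgebra ℂ 𝔸] [CompleteSpace 𝔸] [FiniteDimensional ℝ 𝔸] [Fintype ι] in
/-- the block `ℓ²` reading is bounded by `√|sites|` times a uniform bound of the function. [cite: Balaban1985BackgroundPropagators, (3.46) p.398, bookkeeping] -/
theorem l2OfY_le_of_bound {h : SiteY x.toKIdx → ℝ} (hh : ∀ z, 0 ≤ h z ∧ h z ≤ 1) {Ψ : SiteY x.toKIdx → 𝔸} {C : ℝ} (hC : 0 ≤ C) (hΨ : ∀ z, ‖Ψ z‖ ≤ C) :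
    l2OfY h Ψ ≤ Real.sqrt (Fintype.card (SiteY x.toKIdx)) * C := by
  unfold l2OfY
  rw [← Real.sqrt_sq hC, ← Real.sqrt_mul (Nat.cast_nonneg _)]
  refine Real.sqrt_le_sqrt ?_
  calc ∑ z, (h z * ‖Ψ z‖) ^ 2 ≤ ∑ _z : SiteY x.toKIdx, C ^ 2 := Finset.sum_le_sum fun z _ => by
          have h1 : h z * ‖Ψ z‖ ≤ C := by nlinarith [(hh z).1, (hh z).2, norm_nonneg (Ψ z), hΨ z]
          have h2 : 0 ≤ h z * ‖Ψ z‖ := mul_nonneg (hh z).1 (norm_nonneg _)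
          nlinarith
    _ = Fintype.card (SiteY x.toKIdx) * C ^ 2 := by rw [Finset.sum_const, Finset.card_univ, nsmul_eq_mul]

/-- the block `ℓ²` reading of `T(g ⊗ E)` is bounded uniformly over the unit ball (finite dimension).
[cite: Balaban1985BackgroundPropagators, (3.46) p.398, bookkeeping] -/
theorem exists_ball_bound_l2OfY (T : (SiteY x.toKIdx → 𝔸) →ₗ[ℝ] (SiteY x.toKIdx → 𝔸)) (g : SiteY x.toKIdx → ℝ) {h : SiteY x.toKIdx → ℝ}
    (hh : ∀ z, 0 ≤ h z ∧ h z ≤ 1) : ∃ C : ℝ, ∀ E : BallY 𝔸, l2OfY h (T (liftY g (E : 𝔸))) ≤ C := by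
  obtain ⟨C, hC, H⟩ := exists_ball_bound x T g
  exact ⟨Real.sqrt (Fintype.card (SiteY x.toKIdx)) * C, fun E => l2OfY_le_of_bound x hh hC (H E)⟩

end Tools

/-! ## §2 ★★ The `L²` block gives the block-`ℓ²` majorant of `conj b (η²·O)` -/

section Read

variable (x : MemberY d ℓ hd hL b₀ b₁ Mstar) (ιB : BlkY x.toKIdx → IBondY x.toKIdx) {ι : Type} [Fintype ι] (b : Module.Basis ι ℝ 𝔸)
  [Fintype (geo9Y x).Site] [DecidableEq (geo9Y x).Site]

/-- ★★ **THE (3.46) READING, ENTRY 0**: at a member with a section `ιB` of `β`, for every backgrounds record, decoding, operator, transporter and configuration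
`c`, the `L²` block `L2Block (kernelFamilyS …) B₀ δ c` (`B₀ ≥ 0`) gives the block-`ℓ²` majorant of the letter `conj b (η²·O(cfg c))` on the real coordinate lattice
with `K(a,a′) = c_L·B₀·ℓ(a)²·e^{−δd(a,a′)}`, `c_L = √|ι|·M₂·Σ_j‖b_j‖` (δ-independent).  Route: a source `u` supported in the labelled block `y′` decomposes as
`Σ_j u(·,j) ⊗ b_j`; the `ℓ²` size of the conj-`b` piece on `Δ(y)` is `≤ √|ι|·M₂·‖1_{Δ(y)}·(η²O Λ_u)‖₂ ≤ √|ι|·M₂·η²·Σ_j ‖b_j‖·‖1_{Δ(y)}·O(u_j ⊗ E_j)‖₂`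
(`E_j = b_j∕‖b_j‖` in the unit ball), and each term is read by the `L²` block at `(n = 0, λ = u_j, h = 1_{Δ(y)})`.
[cite: Balaban1985BackgroundPropagators, Thm 3.1 (3.46) p.398, (3.39)–(3.41) p.397; Balaban1984PropagatorsII, (2.51)–(2.52) p.232] -/
theorem hasL2Majorant_conj_of_l2Block (hι : ∀ s : BlkY x.toKIdx, β x.toKIdx.hN x.toKIdx.D x.toKIdx.hk (ιB s) = s)
    {M₂ : ℝ} (hM₂ : 0 ≤ M₂) (hrepr : ∀ (v : 𝔸) (j : ι), |b.repr v j| ≤ M₂ * ‖v‖) (R : ℝ) (H : Prop)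
    (B : B9.Backgrounds) (cfg : B.Cfg → CfgY 𝔸 x.toKIdx) (O : SiteOpY 𝔸 x.toKIdx) (par : SiteParY 𝔸 x.toKIdx) {B₀ δ : ℝ} (hB₀ : 0 ≤ B₀) {c : B.Cfg}
    (hL2 : L2Block (kernelFamilyS x.toKIdx B cfg O par) B₀ δ c) :
    HasL2Majorant (g := toB6 (geo9Y x) R H) (fun p : SiteY x.toKIdx × ι => blkC x.toKIdx ιB p.1)
      (conj b (((kGeo x.toKIdx).eta ^ 2) • (O (cfg c)).restrictScalars ℝ))
      (fun a a' => (Real.sqrt (Fintype.card ι) * M₂ * ∑ j, ‖b j‖) * B₀ * (geo9Y x).len a ^ 2 * Real.exp (-(δ * (geo9Y x).dist a a'))) := by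
  intro y y' u hu
  set U := cfg c with hU
  set η := (kGeo x.toKIdx).eta with hηdef
  have hη0 : 0 < η := geo9K_eta_pos x.toKIdx
  set T : Module.End ℝ (SiteY x.toKIdx → 𝔸) := (η ^ 2) • (O U).restrictScalars ℝ with hT
  have hind := indY_nonneg_le_one x ιB y
  -- the conj-`b` piece against the 𝔸-valued block reading
  have h1 := l2n_blockPiece_conj_le x ιB b hM₂ hrepr R H T u y
  -- T Λ_u = η² Σ_j ‖b_j‖ • O U (u_j ⊗ E_j)
  have hne : ∀ j, ‖b j‖ ≠ 0 := fun j => norm_ne_zero_iff.2 (b.ne_zero j)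
  set uj : ι → SiteY x.toKIdx → ℝ := fun j z => u (z, j) with huj
  set Ej : ι → 𝔸 := fun j => (‖b j‖⁻¹ : ℂ) • b j with hEj
  have hEj1 : ∀ j, ‖Ej j‖ ≤ 1 := fun j => by
    rw [hEj]; dsimp only
    rw [norm_smul, norm_inv, Complex.norm_real, Real.norm_eq_abs, abs_norm, inv_mul_cancel₀ (hne j)]
  have hbj : ∀ j, b j = (‖b j‖ : ℂ) • Ej j := fun j => by
    rw [hEj]; dsimp only
    rw [smul_smul, mul_inv_cancel₀ (by exact_mod_cast hne j), one_smul]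
  have hTΛ : T ((coordEquiv b).symm u) = ((η ^ 2 : ℝ) : ℂ) • ∑ j, ((‖b j‖ : ℝ) : ℂ) • O U (liftY (uj j) (Ej j)) := by
    rw [hT, LinearMap.smul_apply, LinearMap.coe_restrictScalars, coordEquiv_symm_eq_sum_liftY b u, map_sum,
      real_smul_fun]
    congr 1
    refine Finset.sum_congr rfl fun j _ => ?_
    have hl : liftY (fun z => u (z, j)) (b j) = ((‖b j‖ : ℝ) : ℂ) • liftY (uj j) (Ej j) := by
      funext z
      rw [Pi.smul_apply, liftY_apply, liftY_apply, hbj j, smul_comm]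
      rw [← hbj j]
    rw [hl, map_smul]
  -- the 𝔸-valued block reading of T Λ_u, term by term
  have h2 : l2OfY (indY x ιB y) (T ((coordEquiv b).symm u)) ≤ η ^ 2 * ∑ j, ‖b j‖ * l2OfY (indY x ιB y) (O U (liftY (uj j) (Ej j))) := by
    rw [hTΛ, l2OfY_smul, Complex.norm_real, Real.norm_eq_abs, abs_of_nonneg (pow_nonneg hη0.le 2)]
    refine mul_le_mul_of_nonneg_left ?_ (pow_nonneg hη0.le 2)
    refine (l2OfY_sum_le x (fun z => (hind z).1) Finset.univ _).trans (Finset.sum_le_sum fun j _ => ?_)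
    rw [l2OfY_smul, Complex.norm_real, Real.norm_eq_abs, abs_norm]
  -- each term is read by the L² block at (n = 0, λ = u_j, h = 1_{Δ(y)})
  have h3 : ∀ j, η ^ 2 * l2OfY (indY x ιB y) (O U (liftY (uj j) (Ej j))) ≤
      B₀ * (geo9Y x).len y ^ 2 * Real.exp (-(δ * (geo9Y x).dist y y')) * l2n u := by
    intro j
    have hs : (geo9Y x).suppIn (.inl (uj j)) y' := suppIn_inl_of_blkC x ιB hι fun z hz => hu (z, j) hz
    have hread := hL2 0 (.inl (uj j)) (.inl (indY x ιB y)) y y' (cutIn_indY x ιB hι y) hs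
    have hK : (kernelFamilyS x.toKIdx B cfg O par).l2 0 c (.inl (uj j)) (.inl (indY x ιB y)) =
        etaS x.toKIdx ^ 2 * ⨆ E : BallY 𝔸, l2OfY (indY x ιB y) (O U (liftY (uj j) (E : 𝔸))) := rfl
    have hp : B9.pref6 ((B9GeoNormsKLevelV1.geo9K x.toKIdx).len y) 0 = (geo9Y x).len y ^ 2 := rfl
    rw [hK, hp, etaS_eq_eta] at hread
    have hsup : l2OfY (indY x ιB y) (O U (liftY (uj j) (Ej j))) ≤ ⨆ E : BallY 𝔸, l2OfY (indY x ιB y) (O U (liftY (uj j) (E : 𝔸))) :=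
      le_iSup_ball (A := fun E : BallY 𝔸 => l2OfY (indY x ιB y) (O U (liftY (uj j) (E : 𝔸))))
        (exists_ball_bound_l2OfY x ((O U).restrictScalars ℝ) (uj j) hind) ⟨Ej j, mem_closedBall_zero_iff.2 (hEj1 j)⟩
    have hcut : (geo9Y x).cutSup (.inl (indY x ιB y)) ≤ 1 := supF_indY_le_one x ιB y
    have hl2 : (geo9Y x).l2Norm (.inl (uj j)) ≤ l2n u := l2Norm_col_le x u j
    have hpos : 0 ≤ B₀ * (geo9Y x).len y ^ 2 := mul_nonneg hB₀ (sq_nonneg _)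
    have hexp := (Real.exp_pos (-(δ * (geo9Y x).dist y y'))).le
    have hl2n := B9GeoNormsKLevelV1.geo9K_l2Norm_nonneg x.toKIdx (Sum.inl (uj j))
    calc η ^ 2 * l2OfY (indY x ιB y) (O U (liftY (uj j) (Ej j)))
        ≤ η ^ 2 * ⨆ E : BallY 𝔸, l2OfY (indY x ιB y) (O U (liftY (uj j) (E : 𝔸))) := mul_le_mul_of_nonneg_left hsup (pow_nonneg hη0.le 2)
      _ ≤ B₀ * (geo9Y x).len y ^ 2 * (geo9Y x).cutSup (.inl (indY x ιB y)) * Real.exp (-(δ * (geo9Y x).dist y y')) *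
            (geo9Y x).l2Norm (.inl (uj j)) := hread
      _ ≤ B₀ * (geo9Y x).len y ^ 2 * 1 * Real.exp (-(δ * (geo9Y x).dist y y')) * l2n u := by gcongr
      _ = B₀ * (geo9Y x).len y ^ 2 * Real.exp (-(δ * (geo9Y x).dist y y')) * l2n u := by ring
  -- assemble
  have hSb : 0 ≤ ∑ j, ‖b j‖ := Finset.sum_nonneg fun _ _ => norm_nonneg _
  have h4 : η ^ 2 * ∑ j, ‖b j‖ * l2OfY (indY x ιB y) (O U (liftY (uj j) (Ej j))) ≤
      (∑ j, ‖b j‖) * (B₀ * (geo9Y x).len y ^ 2 * Real.exp (-(δ * (geo9Y x).dist y y')) * l2n u) := by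
    rw [Finset.mul_sum, Finset.sum_mul]
    refine Finset.sum_le_sum fun j _ => ?_
    calc η ^ 2 * (‖b j‖ * l2OfY (indY x ιB y) (O U (liftY (uj j) (Ej j))))
        = ‖b j‖ * (η ^ 2 * l2OfY (indY x ιB y) (O U (liftY (uj j) (Ej j)))) := by ring
      _ ≤ ‖b j‖ * (B₀ * (geo9Y x).len y ^ 2 * Real.exp (-(δ * (geo9Y x).dist y y')) * l2n u) :=
          mul_le_mul_of_nonneg_left (h3 j) (norm_nonneg _)
  calc l2n (blockPiece (g := toB6 (geo9Y x) R H) (fun p : SiteY x.toKIdx × ι => blkC x.toKIdx ιB p.1) y (conj b T u))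
      ≤ Real.sqrt (Fintype.card ι) * M₂ * l2OfY (indY x ιB y) (T ((coordEquiv b).symm u)) := h1
    _ ≤ Real.sqrt (Fintype.card ι) * M₂ * ((∑ j, ‖b j‖) * (B₀ * (geo9Y x).len y ^ 2 * Real.exp (-(δ * (geo9Y x).dist y y')) * l2n u)) :=
        mul_le_mul_of_nonneg_left (h2.trans h4) (by positivity)
    _ = (Real.sqrt (Fintype.card ι) * M₂ * ∑ j, ‖b j‖) * B₀ * (geo9Y x).len y ^ 2 * Real.exp (-(δ * (geo9Y x).dist y y')) * l2n u := by ring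

/-- ★ **THE RECORD's LETTER `Gop` AT A BASE**: `L2Block (KSC-type reading of G′ …)` — here for def-Y's plain reading `kernelFamilyS … (GpY par) par` at `U` — gives the
block-`ℓ²` majorant of `B9SectBGpLettersY.GopC … (base U)` (the first conjunct of `L2Frame₂.readL2` at NODE 00's letters, constant `c_L·B₀`).
[cite: Balaban1985BackgroundPropagators, Thm 3.1 (3.46) p.398; Balaban1984PropagatorsII, (2.51) p.232] -/
theorem hasL2Majorant_GopC_base_of_l2Block (hι : ∀ s : BlkY x.toKIdx, β x.toKIdx.hN x.toKIdx.D x.toKIdx.hk (ιB s) = s)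
    {M₂ : ℝ} (hM₂ : 0 ≤ M₂) (hrepr : ∀ (v : 𝔸) (j : ι), |b.repr v j| ≤ M₂ * ‖v‖) (R : ℝ) (H : Prop)
    (B : B9.Backgrounds) (cfg : B.Cfg → CfgY 𝔸 x.toKIdx) (par : SiteParY 𝔸 x.toKIdx) {B₀ δ : ℝ} (hB₀ : 0 ≤ B₀) {c : B.Cfg}
    (hL2 : L2Block (kernelFamilyS x.toKIdx B cfg (GpY x.toKIdx par) par) B₀ δ c) :
    HasL2Majorant (g := toB6 (geo9Y x) R H) (fun p : SiteY x.toKIdx × ι => blkC x.toKIdx ιB p.1) (GopC x.toKIdx par b (.base (cfg c)))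
      (fun a a' => (Real.sqrt (Fintype.card ι) * M₂ * ∑ j, ‖b j‖) * B₀ * (geo9Y x).len a ^ 2 * Real.exp (-(δ * (geo9Y x).dist a a'))) :=
  hasL2Majorant_conj_of_l2Block x ιB b hι hM₂ hrepr R H B cfg (GpY x.toKIdx par) par hB₀ hL2

end Read

end Literature.MathematicalPhysics.QuantumFieldTheory.Balaban1983to89.B9SectBL2ReadingsY
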